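import Summits.QuantumFields.QCD.Theorems.NestedDissectionSeaEarlyCrosserLawStubQuasimodeUnionBound
import Summits.QuantumFields.QCD.Theorems.NestedDissectionSeaEarlyCrosserLawCoverReduction

/-!
# Stub `measurableSet_faceHeavyCrossingEvent` of line `cells-inherit-torus-extinction`
(crux `Summit.QuantumFields.QCD.Theses.NestedDissectionSea.EarlyCrosserLaw`, item stmt-QuantumFields-13995)

The CHARGED EVENT of the line's sheet-attached rarity stub S3′ is Borel measurable: for a window
box `(x, s)`, a compact bare-mass interval `[lo, hi]` and a threshold `θ`, the set of `SU(3)`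
gauge fields `U` for which the Dirichlet cell `wilsonCell U μ' x s` is singular at some
`μ' ∈ [lo, hi]` with a kernel vector `w ≠ 0` whose FACE MASS (sites with some coordinate offset
`(q − x)_i` equal to `1` or `s_i − 1`) exceeds `θ ‖w‖₂²`.

Proof (the pattern of `KacRiceHermitianDos.QuasimodeUnionBound.measurableSet_quasimode`, two
extra coordinates). On the σ-compact parameter space
`GaugeConfig 4 N SU3 × (ℝ × ({p // wilsonBox x s p} → ℂ))` (compact × finite-dimensional) the
conditions `lo ≤ μ'`, `μ' ≤ hi`, `wilsonCell U μ' x s *ᵥ w = 0` are CLOSED — the cell matrix is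
jointly continuous in `(U, μ')` since the bare mass enters additively,
`D_c(U, μ') = D_c(U, 0) + μ' • 1` (`CoverReduction.wilsonCell_eq_add_smul_one`,
`continuous_wilsonCell`) — and `w ≠ 0 ⟺ 0 < ‖w‖`, `θ ‖w‖₂² < faceMass(w)` are two STRICT
inequalities of continuous functions, so the solution set is σ-compact
(`isSigmaCompact_inter_lt`, twice); the event is its first projection, σ-compact
(`IsSigmaCompact.image`), hence measurable in the Hausdorff Borel configuration space
(`measurableSet_of_isSigmaCompact`). No new definitions.
-/

noncomputable section

open scoped BigOperators Classical
open Matrix Complex Filter MeasureTheory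
open Literature.MathematicalPhysics.QuantumLattice Literature.MathematicalPhysics.QuantumFieldTheory
  Literature.Probability.LatticeModels
open Summit.QuantumFields.QCD.Theses.NestedDissectionSea

namespace Summit.QuantumFields.QCD.Cruxes.EarlyCrosserLaw.CellsInheritTorusExtinction

open Summit.QuantumFields.QCD.Cruxes.CoerciveSea.ChiralityCollapsesPseudospectrum.CensusDominates
open Summit.QuantumFields.QCD.Cruxes.EarlyCrosserLaw.KacRiceHermitianDos

variable {N : ℕ} [NeZero N]

omit [NeZero N] in
/-- The Dirichlet cell matrix is JOINTLY continuous in the gauge field and the bare mass: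
`D_c(U, μ) = D_c(U, 0) + μ • 1` with `U ↦ D_c(U, 0)` continuous. -/
theorem continuous_wilsonCell₂ (x : TorusSite 4 N) (s : Fin 4 → ℕ) :
    Continuous fun q : GaugeConfig 4 N SU3 × ℝ => wilsonCell q.1 q.2 x s := by
  have h : (fun q : GaugeConfig 4 N SU3 × ℝ => wilsonCell q.1 q.2 x s) =
      fun q => wilsonCell q.1 0 x s + (((q.2 - 0 : ℝ)) : ℂ) • (1 : Matrix _ _ ℂ) :=
    funext fun q => CoverReduction.wilsonCell_eq_add_smul_one q.1 q.2 0 x s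
  rw [h]
  exact ((continuous_wilsonCell 0 x s).comp continuous_fst).add
    ((Complex.continuous_ofReal.comp (continuous_snd.sub continuous_const)).smul continuous_const)

/-- The CLOSED conditions of the face-heavy crossing event (`lo ≤ μ' ≤ hi`, `D_c(U, μ') w = 0`)
cut out a closed subset of the parameter space `(U, μ', w)`. -/
theorem isClosed_faceHeavyCore (x : TorusSite 4 N) (s : Fin 4 → ℕ) (lo hi : ℝ) :
    IsClosed {q : GaugeConfig 4 N SU3 × (ℝ × ({p // wilsonBox x s p} → ℂ)) |
      lo ≤ q.2.1 ∧ q.2.1 ≤ hi ∧ wilsonCell q.1 q.2.1 x s *ᵥ q.2.2 = 0} := by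
  have hμ : Continuous fun q : GaugeConfig 4 N SU3 × (ℝ × ({p // wilsonBox x s p} → ℂ)) =>
      q.2.1 := continuous_snd.fst
  have hc : Continuous fun q : GaugeConfig 4 N SU3 × (ℝ × ({p // wilsonBox x s p} → ℂ)) =>
      wilsonCell q.1 q.2.1 x s :=
    (continuous_wilsonCell₂ x s).comp (continuous_fst.prodMk hμ)
  have hmv : Continuous fun q : GaugeConfig 4 N SU3 × (ℝ × ({p // wilsonBox x s p} → ℂ)) =>
      wilsonCell q.1 q.2.1 x s *ᵥ q.2.2 :=
    hc.matrix_mulVec continuous_snd.snd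
  simp only [Set.setOf_and]
  exact (isClosed_le continuous_const hμ).inter
    ((isClosed_le hμ continuous_const).inter (isClosed_eq hmv continuous_const))

/-- The solution set of the face-heavy crossing event in the parameter space `(U, μ', w)` — the
closed core cut by the strict inequalities `0 < ‖w‖` and `θ ‖w‖₂² < faceMass(w)` — is
σ-compact. -/
theorem isSigmaCompact_faceHeavy (x : TorusSite 4 N) (s : Fin 4 → ℕ) (lo hi θ : ℝ) :
    IsSigmaCompact (({q : GaugeConfig 4 N SU3 × (ℝ × ({p // wilsonBox x s p} → ℂ)) |
        lo ≤ q.2.1 ∧ q.2.1 ≤ hi ∧ wilsonCell q.1 q.2.1 x s *ᵥ q.2.2 = 0} ∩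
        {q | (0 : ℝ) < ‖q.2.2‖}) ∩
      {q | θ * ∑ p, ‖q.2.2 p‖ ^ 2 < ∑ p : {p // wilsonBox x s p},
        (if (∃ i, (p.1.1 i - x i).val = 1 ∨ (p.1.1 i - x i).val + 1 = s i) then ‖q.2.2 p‖ ^ 2
          else 0)}) := by
  have h2 : ∀ p : {p // wilsonBox x s p},
      Continuous fun q : GaugeConfig 4 N SU3 × (ℝ × ({p // wilsonBox x s p} → ℂ)) => q.2.2 p :=
    fun p => (continuous_apply p).comp continuous_snd.snd
  have hL : Continuous fun q : GaugeConfig 4 N SU3 × (ℝ × ({p // wilsonBox x s p} → ℂ)) =>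
      θ * ∑ p, ‖q.2.2 p‖ ^ 2 :=
    continuous_const.mul (continuous_finsetSum _ fun p _ => (h2 p).norm.pow 2)
  have hR : Continuous fun q : GaugeConfig 4 N SU3 × (ℝ × ({p // wilsonBox x s p} → ℂ)) =>
      ∑ p : {p // wilsonBox x s p},
        (if (∃ i, (p.1.1 i - x i).val = 1 ∨ (p.1.1 i - x i).val + 1 = s i) then ‖q.2.2 p‖ ^ 2
          else 0) :=
    continuous_finsetSum _ fun p _ =>
      continuous_if_const _ (fun _ => (h2 p).norm.pow 2) fun _ => continuous_const
  exact isSigmaCompact_inter_lt (isSigmaCompact_inter_lt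
    (isSigmaCompact_univ.of_isClosed_subset (isClosed_faceHeavyCore x s lo hi) (Set.subset_univ _))
    continuous_const continuous_snd.snd.norm) hL hR

/-- **The face-heavy crossing event is Borel measurable**: the set of gauge fields whose Dirichlet
cell of the box `(x, s)` is singular at some bare mass `μ' ∈ [lo, hi]`, with a kernel vector
`w ≠ 0` of face mass `> θ ‖w‖₂²`, is the first projection of a σ-compact subset of
`(U, μ', w)`-space, so it is σ-compact, hence measurable in the Hausdorff Borel configuration
space. -/
theorem measurableSet_faceHeavyCrossingEvent {N : ℕ} [NeZero N] (x : TorusSite 4 N)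
    (s : Fin 4 → ℕ) (lo hi θ : ℝ) :
    MeasurableSet {U : GaugeConfig 4 N SU3 | ∃ μ' : ℝ, lo ≤ μ' ∧ μ' ≤ hi ∧
      ∃ w : {p // wilsonBox x s p} → ℂ, w ≠ 0 ∧ wilsonCell U μ' x s *ᵥ w = 0 ∧
        θ * ∑ q, ‖w q‖ ^ 2 < ∑ q : {p // wilsonBox x s p},
          (if (∃ i, (q.1.1 i - x i).val = 1 ∨ (q.1.1 i - x i).val + 1 = s i) then ‖w q‖ ^ 2
            else 0)} := by
  have h : {U : GaugeConfig 4 N SU3 | ∃ μ' : ℝ, lo ≤ μ' ∧ μ' ≤ hi ∧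
      ∃ w : {p // wilsonBox x s p} → ℂ, w ≠ 0 ∧ wilsonCell U μ' x s *ᵥ w = 0 ∧
        θ * ∑ q, ‖w q‖ ^ 2 < ∑ q : {p // wilsonBox x s p},
          (if (∃ i, (q.1.1 i - x i).val = 1 ∨ (q.1.1 i - x i).val + 1 = s i) then ‖w q‖ ^ 2
            else 0)} =
      Prod.fst '' (({q : GaugeConfig 4 N SU3 × (ℝ × ({p // wilsonBox x s p} → ℂ)) |
          lo ≤ q.2.1 ∧ q.2.1 ≤ hi ∧ wilsonCell q.1 q.2.1 x s *ᵥ q.2.2 = 0} ∩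
          {q | (0 : ℝ) < ‖q.2.2‖}) ∩
        {q | θ * ∑ p, ‖q.2.2 p‖ ^ 2 < ∑ p : {p // wilsonBox x s p},
          (if (∃ i, (p.1.1 i - x i).val = 1 ∨ (p.1.1 i - x i).val + 1 = s i) then ‖q.2.2 p‖ ^ 2
            else 0)}) := by
    ext U
    simp only [Set.mem_setOf_eq, mem_image_fst, Set.mem_inter_iff, norm_pos_iff, Prod.exists]
    constructor
    · rintro ⟨μ', h1, h2, w, hw, hD, hlt⟩
      exact ⟨μ', w, ⟨⟨h1, h2, hD⟩, hw⟩, hlt⟩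
    · rintro ⟨μ', w, ⟨⟨h1, h2, hD⟩, hw⟩, hlt⟩
      exact ⟨μ', h1, h2, w, hw, hD, hlt⟩
  rw [h]
  exact measurableSet_of_isSigmaCompact ((isSigmaCompact_faceHeavy x s lo hi θ).image continuous_fst)

end Summit.QuantumFields.QCD.Cruxes.EarlyCrosserLaw.CellsInheritTorusExtinction

end
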